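import Literature.AnabelianGeometry.EtaleTheta.DoubleUnderline
import Literature.AnabelianGeometry.EtaleTheta.SingleUnderline
import HarnessLib

/-!
# [EtTh] Prop. 2.2 (ii) / Def. 2.7 in the §1 model: cocycle data for the choice `X̲̲` (part 1)

Mochizuki, *The étale theta function and its Frobenioid-theoretic manifestations*, Publ. RIMS **45**
(2009), §2: Prop. 2.2 (ii) (PRIMS PDF p. 37) "any section of the `H¹(G_K, Δ_Θ)`-torsor of splittings
… determines a covering `X̲̲ → X`"; Def. 2.7 (p. 41) "it is a tautology that, upon restriction to
the covering `Ÿ̲̲ → Ÿ` [… determined, in effect, by the choice of a splitting of `D_x → G_K`] the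
class `η̈^Θ` determines a class `η̲̈^Θ ∈ H¹(Π^tp_Ÿ̲̲, l·Δ_Θ)`" [cite: MochizukiEtTh2009, Def 2.7 p.41].

Cell abc-iut, layer L2, item N3 (existence of the choice `X̲̲`; seat abc-iut-L2-t7), stage 2. Seat
abc-iut-L2-t8 typed THE CHOICE `X̲̲` over the §1 root as the structure `EtaleThetaData.DoubleUnderline`
(`DoubleUnderline.lean`, fields = the printed properties). This file CONSTRUCTS one in the §1 model
from COCYCLE DATA (`XuuCocycleData`), reading p. 41's "tautology" as the definition: `Π^tp_X̲̲` is the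
ZERO SET modulo `l·Δ_Θ` of a continuous mod-`l·Δ_Θ` 1-cocycle `F` on `Π^tp_X̲ = toZ⁻¹(l·Z)`
(`SingleUnderline.lean`) which (a) restricts on `Π^tp_Ÿ` to a representative of the étale theta class
`η̈^Θ` modulo `l·Δ_Θ` and (b) is `δ ↦ θ(δ)^e` on the part of `Δ^tp_X̲` over `Δ_Θ` (Prop. 1.3, p. 20:
the restriction of `η^Θ` to the geometric part "is the natural isomorphism" onto `Δ_Θ ⊗ ℤ/N`;
`e = 1` in print). THIS PART: the data (`XuuCocycleData`), the reduction `F̄ : Π^tp_X̲ → Δ_Θ/l·Δ_Θ`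
as an honest cocycle for the induced action (`Fbar_mul`), the zero set `Huu0 ⊆ Π^tp_X̲` (a subgroup
by the cocycle identity; open), "cosets ↔ values" (`inv_mul_mem_Huu0_iff`) and ABSORPTION: by (b)
every value is attained on `Δ^tp_Ÿ`, so `Π^tp_X̲ = Π^tp_X̲̲ · Δ^tp_Ÿ` (`exists_mul_mem_Huu0`). Part 2
(`DoubleUnderlineOfCocycle.lean`) proves all of t8's fields and assembles the `DoubleUnderline`.
INPUTS NOT DISCHARGED (fields of `XuuCocycleData`: data/hypotheses quoting print, never named facts):
the extension `F` of `η̈^Θ mod l` from `Π^tp_Ÿ` to `Π^tp_X̲` (in print: the section of `D_x ↠ G_K`,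
Prop. 2.2 (ii), with the `l·Z`-invariance of `η̈^Θ` modulo `l`-th powers, Prop. 1.4 (ii)); the
normalisation (b); `[Δ_Θ : l·Δ_Θ] = l` with `l·Δ_Θ` relatively open (`Δ_Θ ≅ Ẑ(1)`, p. 12);
`K = K̈` (`Sec2Hyps`) and `Compat`. Nothing here asserts that such data exist; typed ≠ endorsed; no
side is taken on any disputed claim.
-/

noncomputable section

namespace Literature.AnabelianGeometry.EtaleTheta

open Literature.AnabelianGeometry.SemiGraphs

namespace ThetaSetting

variable {p : ℕ} [Fact p.Prime] {D : ThetaSetting p}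

/-- `Π^tp_Ÿ ⊆ Π^tp_X̲` (`Ÿ → Y → X̲`). [cite: MochizukiEtTh2009, Def 2.7 p.41] -/
theorem GtpYdd_le_GtpXu (l : ℕ) : D.GtpYdd ≤ D.GtpXu l :=
  D.GtpYdd_le_GtpY.trans (D.GtpY_le_GtpXu l)

/-- Under `K = K̈`, `Π^tp_Ÿ` maps onto `G_K` (`Π^tp_Ÿ = Π^tp_{Y₂}`, `(Π^tp_{Y₂}).map aug = G_{K₂} = G_K̈ = G_K`).
[cite: MochizukiEtTh2009, Def 2.7 p.41] -/
theorem map_aug_GtpYdd (hS : D.Sec2Hyps) : D.GtpYdd.map D.aug.toMonoidHom = D.GK := by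
  rw [GtpYdd_eq_GtpYN_two hS, D.map_aug_GtpYN 2]
  exact hS.GKdd_eq

namespace EtaleThetaData

variable {E : D.EtaleThetaData} {l : ℕ}

/-- **Cocycle data for the choice of `X̲̲`** (Prop. 2.2 (ii), Def. 2.7 p. 41): a representative `f`
of `η̈^Θ ∈ H¹(Π^tp_Ÿ, Δ_Θ)` and a continuous `F : Π^tp_X̲ → Δ_Θ`, a 1-cocycle MODULO `l·Δ_Θ` for the
conjugation action through `θ = toTheta`, restricting to `f` modulo `l·Δ_Θ` on `Π^tp_Ÿ` (in print the
extension to `X̲` is the choice of a splitting of `D_x ↠ G_K`) and equal to `θ^e` on the part of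
`Δ^tp_X̲` over `Δ_Θ` (Prop. 1.3: "the natural isomorphism"; "maps the inertia group `I_x`
isomorphically onto `Δ_Θ`", p. 35), with `[Δ_Θ : l·Δ_Θ] = l`, `l·Δ_Θ` open in `Δ_Θ` (`Δ_Θ ≅ Ẑ(1)`),
`l` odd, `K = K̈`, the §1 compatibilities. Data quoting print; not asserted to exist.
[cite: MochizukiEtTh2009, Def 2.7 p.41] -/
structure XuuCocycleData (E : D.EtaleThetaData) (l : ℕ) where
  /-- `l` is odd ([IUTchI] Rmk. 3.1.6) -/
  l_odd : Odd l
  /-- `K = K̈` and `Ker((Π^tp_Y)^Θ ↠ (Π^tp_Y)^ell) ⊆ Π^tp_{Y_N}` (seat t8's `Sec2Hyps`) -/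
  sec2 : D.Sec2Hyps
  /-- the §1 compatibilities (`Δ_Θ ⊆ θ(Δ^tp_Ÿ)`, …) -/
  compat : D.Compat
  /-- `[Δ_Θ : l·Δ_Θ] = l` (`Δ_Θ ≅ Ẑ(1)`) -/
  index_lDeltaTheta : ((D.lDeltaTheta l).subgroupOf D.DeltaTheta).index = l
  /-- `l·Δ_Θ` is open in `Δ_Θ` (`Δ_Θ ≅ Ẑ(1)` compact) -/
  isOpen_lDeltaTheta :
    IsOpen (((D.lDeltaTheta l).subgroupOf D.DeltaTheta : Subgroup D.DeltaTheta) : Set D.DeltaTheta)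
  /-- a continuous cocycle representing `η̈^Θ` -/
  f : contCocycles D.toTheta D.DeltaTheta D.GtpYdd
  /-- `[f] = η̈^Θ` -/
  mk_f : ContH1.mk f.1 f.2 = E.etaDd
  /-- the extension to `Π^tp_X̲`, modulo `l·Δ_Θ` -/
  F : ↥(D.GtpXu l) → ↥D.DeltaTheta
  /-- `F` is continuous -/
  continuous_F : Continuous F
  /-- `F` is a 1-cocycle modulo `l·Δ_Θ`: `F(gh) ≡ F(g) · θ(g) F(h) θ(g)⁻¹` -/
  cocycle_F : ∀ g h : ↥(D.GtpXu l),
    (F (g * h))⁻¹ * (F g * MulAut.conjNormal (D.toTheta (g : D.PiTemp)) (F h)) ∈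
      (D.lDeltaTheta l).subgroupOf D.DeltaTheta
  /-- `F|_{Π^tp_Ÿ} ≡ f` modulo `l·Δ_Θ` -/
  F_res : ∀ h : ↥D.GtpYdd,
    (F ⟨h, GtpYdd_le_GtpXu l h.2⟩)⁻¹ * f.1 h ∈ (D.lDeltaTheta l).subgroupOf D.DeltaTheta
  /-- the orientation exponent: `F ≡ θ^e` over `Δ_Θ` (in print `e = 1`: the restriction of `η^Θ`
  to the geometric part is "the natural isomorphism" onto `Δ_Θ ⊗ ℤ/N`, Prop. 1.3 p. 20; any `e`
  prime to `l` works, recorded through the two properties below) -/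
  e : ℤ
  /-- `x ↦ x^e` is onto modulo `l·Δ_Θ` -/
  pow_surj : ∀ t : D.DeltaTheta, ∃ s : D.DeltaTheta,
    (s ^ e)⁻¹ * t ∈ (D.lDeltaTheta l).subgroupOf D.DeltaTheta
  /-- `x^e ∈ l·Δ_Θ ⇒ x ∈ l·Δ_Θ` -/
  mem_of_pow_mem : ∀ x : D.DeltaTheta,
    x ^ e ∈ (D.lDeltaTheta l).subgroupOf D.DeltaTheta → x ∈ (D.lDeltaTheta l).subgroupOf D.DeltaTheta
  /-- `F` is tautological over `Δ_Θ`: `F(δ) ≡ θ(δ)^e` for `δ ∈ Δ^tp_X̲` with `θ(δ) ∈ Δ_Θ` ("maps the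
  inertia group `I_x` isomorphically onto `Δ_Θ`", p. 35; Prop. 1.3, p. 20) -/
  F_theta : ∀ (δ : ↥(D.GtpXu l)) (hΔ : (δ : D.PiTemp) ∈ D.DeltaTemp)
    (hθ : D.toTheta (δ : D.PiTemp) ∈ D.DeltaTheta),
    (F δ)⁻¹ * ⟨D.toTheta (δ : D.PiTemp), hθ⟩ ^ e ∈ (D.lDeltaTheta l).subgroupOf D.DeltaTheta

namespace XuuCocycleData

variable (Ξ : XuuCocycleData E l)

/-! ### The mod-`l·Δ_Θ` cocycle as an honest cocycle into `Δ_Θ/l·Δ_Θ` -/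

/-- `l·Δ_Θ` as a subgroup of `Δ_Θ`. [cite: MochizukiEtTh2009, Def 2.7 p.41] -/
abbrev Lsub (D : ThetaSetting p) (l : ℕ) : Subgroup D.DeltaTheta :=
  (D.lDeltaTheta l).subgroupOf D.DeltaTheta

/-- `Δ_Θ/l·Δ_Θ` ("`Δ̄_Θ ≅ (ℤ/lℤ)(1)`", p. 35). [cite: MochizukiEtTh2009, Def 2.1 p.35] -/
abbrev DeltaThetaModL (D : ThetaSetting p) (l : ℕ) : Type := D.DeltaTheta ⧸ Lsub D l

/-- The conjugation action of `x ∈ (Π^tp_X)^Θ` on `Δ_Θ/l·Δ_Θ` (`l·Δ_Θ` is normal in `(Π^tp_X)^Θ`).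
[cite: MochizukiEtTh2009, Def 2.1 p.35] -/
def actBar (D : ThetaSetting p) (l : ℕ) (x : D.GtpTheta) : DeltaThetaModL D l →* DeltaThetaModL D l :=
  QuotientGroup.map (Lsub D l) (Lsub D l) (MulAut.conjNormal x).toMonoidHom (by
    intro a ha
    rw [Subgroup.mem_comap]
    change ((MulAut.conjNormal x a : D.DeltaTheta) : D.GtpTheta) ∈ D.lDeltaTheta l
    rw [MulAut.conjNormal_apply]
    exact (D.lDeltaTheta_normal l).conj_mem _ ha x)

/-- `actBar x [a] = [x a x⁻¹]`. [cite: MochizukiEtTh2009, Def 2.1 p.35] -/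
theorem actBar_mk (x : D.GtpTheta) (a : D.DeltaTheta) :
    actBar D l x (QuotientGroup.mk a) = QuotientGroup.mk (MulAut.conjNormal x a) :=
  rfl

/-- `actBar (x y) = actBar x ∘ actBar y`. [cite: MochizukiEtTh2009, Def 2.1 p.35] -/
theorem actBar_mul_apply (x y : D.GtpTheta) (u : DeltaThetaModL D l) :
    actBar D l (x * y) u = actBar D l x (actBar D l y u) := by
  induction u using QuotientGroup.induction_on with
  | H a => rw [actBar_mk, actBar_mk, actBar_mk, map_mul, MulAut.mul_apply]

/-- `actBar 1 = id`. [cite: MochizukiEtTh2009, Def 2.1 p.35] -/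
theorem actBar_one_apply (u : DeltaThetaModL D l) : actBar D l 1 u = u := by
  induction u using QuotientGroup.induction_on with
  | H a => rw [actBar_mk, map_one, MulAut.one_apply]

/-- `actBar x` is injective (inverse `actBar x⁻¹`). [cite: MochizukiEtTh2009, Def 2.1 p.35] -/
theorem actBar_injective (x : D.GtpTheta) : Function.Injective (actBar D l x) := by
  intro u v huv
  have := congrArg (actBar D l x⁻¹) huv
  rwa [← actBar_mul_apply, ← actBar_mul_apply, inv_mul_cancel, actBar_one_apply,
    actBar_one_apply] at this

/-- `F̄ : Π^tp_X̲ → Δ_Θ/l·Δ_Θ`, the reduction of `F`. [cite: MochizukiEtTh2009, Def 2.7 p.41] -/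
def Fbar (g : ↥(D.GtpXu l)) : DeltaThetaModL D l := QuotientGroup.mk (Ξ.F g)

/-- The cocycle identity for `F̄`: `F̄(gh) = F̄(g) · θ(g)·F̄(h)`. [cite: MochizukiEtTh2009, Def 2.7 p.41] -/
theorem Fbar_mul (g h : ↥(D.GtpXu l)) :
    Ξ.Fbar (g * h) = Ξ.Fbar g * actBar D l (D.toTheta (g : D.PiTemp)) (Ξ.Fbar h) := by
  have hc := Ξ.cocycle_F g h
  rw [← QuotientGroup.eq_one_iff, QuotientGroup.mk_mul, QuotientGroup.mk_inv,
    QuotientGroup.mk_mul, inv_mul_eq_one] at hc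
  rw [Fbar, Fbar, Fbar, actBar_mk]
  exact hc

/-- `F̄(1) = 1`. [cite: MochizukiEtTh2009, Def 2.7 p.41] -/
theorem Fbar_one : Ξ.Fbar 1 = 1 := by
  have h := Ξ.Fbar_mul 1 1
  rw [mul_one, OneMemClass.coe_one, map_one, actBar_one_apply] at h
  -- `h : F̄ 1 = F̄ 1 * F̄ 1`
  exact (mul_left_cancel (a := Ξ.Fbar 1) (by rw [mul_one]; exact h)).symm

/-- `F̄(g⁻¹) = (θ(g)⁻¹·F̄(g))⁻¹`. [cite: MochizukiEtTh2009, Def 2.7 p.41] -/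
theorem Fbar_inv (g : ↥(D.GtpXu l)) :
    Ξ.Fbar g⁻¹ = (actBar D l (D.toTheta ((g⁻¹ : ↥(D.GtpXu l)) : D.PiTemp)) (Ξ.Fbar g))⁻¹ := by
  have h := Ξ.Fbar_mul g⁻¹ g
  rw [inv_mul_cancel, Fbar_one] at h
  exact eq_inv_of_mul_eq_one_left h.symm

/-! ### The zero set `Π^tp_X̲̲` -/

/-- **`Π^tp_X̲̲` inside `Π^tp_X̲`**: the zero set `{g ∈ Π^tp_X̲ | F(g) ∈ l·Δ_Θ}` of `F̄` — a subgroup by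
the cocycle identity. [cite: MochizukiEtTh2009, Def 2.7 p.41] -/
def Huu0 : Subgroup ↥(D.GtpXu l) where
  carrier := {g | Ξ.Fbar g = 1}
  one_mem' := Ξ.Fbar_one
  mul_mem' {g h} hg hh := by
    change Ξ.Fbar (g * h) = 1
    rw [Fbar_mul, hg, hh, map_one, mul_one]
  inv_mem' {g} hg := by
    change Ξ.Fbar g⁻¹ = 1
    rw [Fbar_inv, hg, map_one, inv_one]

/-- Membership in `Π^tp_X̲̲`: `F(g) ∈ l·Δ_Θ`. [cite: MochizukiEtTh2009, Def 2.7 p.41] -/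
theorem mem_Huu0_iff (g : ↥(D.GtpXu l)) :
    g ∈ Ξ.Huu0 ↔ ((Ξ.F g : D.DeltaTheta) : D.GtpTheta) ∈ D.lDeltaTheta l := by
  change Ξ.Fbar g = 1 ↔ _
  rw [Fbar, QuotientGroup.eq_one_iff, Subgroup.mem_subgroupOf]

/-- **Cosets ↔ values**: `g⁻¹h ∈ Π^tp_X̲̲ ⇔ F̄(g) = F̄(h)`. [cite: MochizukiEtTh2009, Def 2.7 p.41] -/
theorem inv_mul_mem_Huu0_iff (g h : ↥(D.GtpXu l)) : g⁻¹ * h ∈ Ξ.Huu0 ↔ Ξ.Fbar g = Ξ.Fbar h := by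
  change Ξ.Fbar (g⁻¹ * h) = 1 ↔ _
  rw [Fbar_mul, Fbar_inv, inv_mul_eq_one]
  exact (actBar_injective _).eq_iff

/-- `Π^tp_X̲̲` is open in `Π^tp_X̲` (`F` continuous, `l·Δ_Θ` open in `Δ_Θ`).
[cite: MochizukiEtTh2009, Def 2.7 p.41] -/
theorem isOpen_Huu0 : IsOpen (Ξ.Huu0 : Set ↥(D.GtpXu l)) := by
  have : (Ξ.Huu0 : Set ↥(D.GtpXu l)) = Ξ.F ⁻¹' ((Lsub D l : Subgroup D.DeltaTheta) : Set D.DeltaTheta) := by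
    ext g
    rw [SetLike.mem_coe, mem_Huu0_iff, Set.mem_preimage, SetLike.mem_coe, Subgroup.mem_subgroupOf]
  rw [this]
  exact Ξ.isOpen_lDeltaTheta.preimage Ξ.continuous_F

/-- `Δ_Θ ⊆ θ(Δ^tp_Ÿ)` (§1 compatibility): every `t ∈ Δ_Θ` is `θ(δ)` with `δ ∈ Δ^tp_X ∩ Π^tp_Ÿ`.
[cite: MochizukiEtTh2009, §1 p.12] -/
theorem exists_toTheta_eq (Ξ : XuuCocycleData E l) (t : D.DeltaTheta) :
    ∃ δ : ↥(D.GtpXu l), (δ : D.PiTemp) ∈ D.DeltaTemp ∧ (δ : D.PiTemp) ∈ D.GtpYdd ∧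
      D.toTheta (δ : D.PiTemp) = t := by
  have hmem : ((t : D.DeltaTheta) : D.GtpTheta) ∈ (D.DtpYddN 1).map D.toTheta :=
    Ξ.compat.deltaTheta_le_DtpYddTheta t.2
  obtain ⟨δ, hδ, hδt⟩ := hmem
  exact ⟨⟨δ, GtpYdd_le_GtpXu l (Subgroup.mem_inf.1 hδ).1⟩, (Subgroup.mem_inf.1 hδ).2,
    (Subgroup.mem_inf.1 hδ).1, hδt⟩

/-- `F̄(δ) = [θ(δ)^e]` for geometric `δ` over `Δ_Θ`. [cite: MochizukiEtTh2009, Def 2.7 p.41] -/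
theorem Fbar_eq_of_toTheta_eq (δ : ↥(D.GtpXu l)) (hΔ : (δ : D.PiTemp) ∈ D.DeltaTemp)
    (t : D.DeltaTheta) (hδt : D.toTheta (δ : D.PiTemp) = t) :
    Ξ.Fbar δ = QuotientGroup.mk (t ^ Ξ.e) := by
  have hθ : D.toTheta (δ : D.PiTemp) ∈ D.DeltaTheta := by rw [hδt]; exact t.2
  have h1 := Ξ.F_theta δ hΔ hθ
  rw [← QuotientGroup.eq_one_iff, QuotientGroup.mk_mul, QuotientGroup.mk_inv,
    inv_mul_eq_one] at h1
  rw [Fbar, h1]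
  congr 2
  exact Subtype.ext hδt

/-- Every class of `Δ_Θ/l·Δ_Θ` is `F̄(δ)` for some `δ ∈ Δ^tp_Ÿ` (`Δ_Θ ⊆ θ(Δ^tp_Ÿ)`, `F ≡ θ^e` there,
`x ↦ x^e` onto mod `l`). [cite: MochizukiEtTh2009, Def 2.7 p.41] -/
theorem exists_Fbar_eq (t : D.DeltaTheta) :
    ∃ δ : ↥(D.GtpXu l), (δ : D.PiTemp) ∈ D.DeltaTemp ∧ (δ : D.PiTemp) ∈ D.GtpYdd ∧
      Ξ.Fbar δ = QuotientGroup.mk t := by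
  obtain ⟨s, hs⟩ := Ξ.pow_surj t
  obtain ⟨δ, hΔ, hY, hδs⟩ := Ξ.exists_toTheta_eq s
  refine ⟨δ, hΔ, hY, ?_⟩
  rw [Ξ.Fbar_eq_of_toTheta_eq δ hΔ s hδs, QuotientGroup.eq, Subgroup.mem_subgroupOf]
  exact hs

/-- **Absorption**: every `g ∈ Π^tp_X̲` can be corrected by some `δ ∈ Δ^tp_Ÿ` into the zero set:
`g·δ ∈ Π^tp_X̲̲` (take `F̄(δ) = θ(g)⁻¹·F̄(g)⁻¹`). [cite: MochizukiEtTh2009, Def 2.7 p.41] -/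
theorem exists_mul_mem_Huu0 (g : ↥(D.GtpXu l)) :
    ∃ δ : ↥(D.GtpXu l), (δ : D.PiTemp) ∈ D.DeltaTemp ∧ (δ : D.PiTemp) ∈ D.GtpYdd ∧ g * δ ∈ Ξ.Huu0 := by
  obtain ⟨δ, hΔ, hY, hF⟩ :=
    Ξ.exists_Fbar_eq (MulAut.conjNormal (D.toTheta (g : D.PiTemp))⁻¹ (Ξ.F g)⁻¹)
  refine ⟨δ, hΔ, hY, ?_⟩
  change Ξ.Fbar (g * δ) = 1
  rw [Fbar_mul, hF, actBar_mk, ← MulAut.mul_apply, ← map_mul, mul_inv_cancel, map_one,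
    MulAut.one_apply, Fbar, ← QuotientGroup.mk_mul, mul_inv_cancel, QuotientGroup.mk_one]

end XuuCocycleData

end EtaleThetaData

end ThetaSetting

end Literature.AnabelianGeometry.EtaleTheta

end
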